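import Mathlib.Analysis.SpecialFunctions.Stirling
import HarnessLib

/-!
# D-0079 RESCUE sub-cell R-H, ROUND 2 Q3 / MIN-SLICE (iv) WINDOW regime — the SLIVER LAW in kernel, part 2 (reals, summed over the bad primes):
# `(l−3)·h < 4l·(ln rad + N·ln X)`, `N·ln N − N ≤ ln rad`, and the SLIVER DISJUNCTION

PROOF-ONLY companion (0 definitions; imports only Mathlib — no tree dependency) of `RHQ3Sliver` (same seat: the per-place law «Σ₈ ⟹ locally log-Szpiro», `localHeight_lt_of_hBand_pilotDataOfK` and
`pow_log_ramIdx_le` supply the hypotheses `hplace` / `hX` below at a genuine datum). Seat abc-iut-rh-typ-2 gen 4 (Q3-typ lane, rh-lead R13; rung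
LADDER-ABC:A2.RESCUE.H); abc-iut-rh-num-1 g2 2026-08-27T00:34:44Z steps (2)–(3) («kernel shape for the typ lane: (2) is a finite sum; (3) is
ln N! ≥ N ln N − N; the fixed point is elementary real arithmetic»; `plan/rescue/R-H/Q3-SLIVER-rh-num-1.tsv` 4b2699061260dc1d; pre-read abc-iut-rh2-ref-3
00:54:23Z (e), fixed point reproduced 6.346 at h = 2^140, E = 60).

The data are ABSTRACT: a nonempty finite set `S` of primes («the bad primes», `N = #S`, `rad = ∏ S`), real local heights `H_p` (at a genuine datum:
`ord_v(q_v)/e(v|p)`), integer exponents `T_p` with `p^{T_p} ≤ X` (`T_p = ⌊log_p e_w⌋`, any `X ≥ max_w e_w`; `X = E·l` on abc-iut-rh-num-1's tables where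
`e_w = e_v·l`, `e_v ≤ E`), and the per-prime law `(l−3)·H_p < 4l·(1 + T_p)` (= `RHQ3Sliver.localHeight_lt_of_hBand_pilotDataOfK`); `h := Σ_p H_p·ln p`,
`R := Σ_p ln p = ln rad`, Szpiro ratio `ρ := h/R`.
* `sliver_sum_lt` **(2): `(l−3)·h < 4l·(R + N·ln X)`** (`T_p·ln p = ln p^{T_p} ≤ ln X`).
* `factorial_card_le_prod` (N distinct primes have product `≥ N!`), `log_factorial_card_le_sum_log`, `card_mul_log_sub_card_le_sum_log`
  **(3): `N·ln N − N ≤ ln rad`** (Mathlib `Stirling.le_log_factorial_stirling`).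
* `sliver` **THE SLIVER DISJUNCTION: for every real `ν > e`, either `(l−3)·h < 4l·(R + ν·ln X)` (few bad primes, `N < ν`) or
  `(l−3)·h < 4l·R·(1 + ln X/(ln ν − 1))` (many: then `N ≤ R/(ln ν − 1)`)**; `sliver_ratio`: the same for `ρ`; `sliver_window`: the two-scale form
  `ν := h^{1−η}`.
READING (numbers are abc-iut-rh-num-1's / abc-iut-rh2-ref-3's, not this file's): with `ν = h^{1−η}` the first branch gives `ρ < (4l/(l−3))·(1 + o(1))`, the
second `ρ < (4l/(l−3))·(1 + θ/(1−η) + o(1))` with `θ := ln X/ln h`; in [IUTchIV]'s window `X ≈ E·l`, `l ∈ [√h, 10δ√h·ln(2δh)]`, so `θ → 1/2` and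
`ρ_max → 4·(1 + 1/2) = 6`: a datum lying WHOLLY in Σ₈ in the window has Szpiro ratio `≤ 6 + ε(h, l)`, `ε(2^140) ≈ 0.35` at the floor (E = 60), `ε → 0` —
the kept slice and the Szpiro-bad locus (`ρ > 6·(1 + O(1/l))`, the p450130 cut) are asymptotically disjoint and meet only in the sliver `6 < ρ ≤ 6 + ε`.
For bounded `N` the first branch alone gives `ρ ≲ 4l/(l−3) < 6` (`l > 9`): not Szpiro-bad at all (abc-iut-rh2-ref-3's remark).
HONEST SCOPE: elementary real arithmetic about an abstract finite set of primes; the dictionary (`S`, `H_p`, `X`, and the relation between `l` and `h` in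
[IUTchIV]'s window) is the reader's, stated above, not a theorem of this file; «Szpiro-bad» in this reading is the `l → ∞` form of the p450130 cut. `HBand`
(row 8) is a claim-tagged hypothesis, never asserted. Nothing here asserts abc; TAKES NO SIDE on [IUTchIII] Cor. 3.12 or on any author.
[cite: Mochizuki2012, IUTchIV Prop. 1.2 (i)(ii) p. 10, Cor. 2.2 (ii) p. 46] [claim: Mochizuki2012, status: disputed] for the reading; the arithmetic is [folklore].
-/

noncomputable section

open Set Function

namespace Summit.ABC.IUTFork.Repair.RH.Q3SliverSum


/-! ## §3. Summed over the bad primes: the SLIVER law (reals, abstract finite set of primes) -/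

section Sum

/-- **(2) THE SUM LAW.** For a nonempty finite set `S` of primes with real local heights `H_p`, integer exponents `T_p` with `p^{T_p} ≤ X`, and the per-prime
law `(l−3)·H_p < 4l·(1 + T_p)` (at a genuine datum: `localHeight_lt_of_hBand_pilotDataOfK`, `T_p = ⌊log_p e_w⌋`, any `X ≥ max_w e_w`):
`(l−3)·Σ_p H_p·ln p < 4l·(Σ_p ln p + N·ln X)`, `N = #S` — since `T_p·ln p = ln p^{T_p} ≤ ln X`. abc-iut-rh-num-1's step (2). [folklore] -/
theorem sliver_sum_lt {S : Finset ℕ} (hS : ∀ p ∈ S, p.Prime) (hne : S.Nonempty) (l : ℕ) (H : ℕ → ℝ) (T : ℕ → ℕ)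
    {X : ℝ} (hX : ∀ p ∈ S, ((p : ℝ)) ^ (T p) ≤ X)
    (hplace : ∀ p ∈ S, ((l : ℝ) - 3) * H p < 4 * (l : ℝ) * (1 + ((T p : ℕ) : ℝ))) :
    ((l : ℝ) - 3) * ∑ p ∈ S, H p * Real.log p < 4 * (l : ℝ) * (∑ p ∈ S, Real.log p + (S.card : ℝ) * Real.log X) := by
  have hterm : ∀ p ∈ S, ((l : ℝ) - 3) * (H p * Real.log p) < 4 * (l : ℝ) * (Real.log p + Real.log X) := by
    intro p hp
    have hp2 : (2 : ℝ) ≤ (p : ℝ) := by exact_mod_cast (hS p hp).two_le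
    have hlogp : 0 < Real.log (p : ℝ) := Real.log_pos (by linarith)
    have h1 : ((l : ℝ) - 3) * H p * Real.log p < 4 * (l : ℝ) * (1 + ((T p : ℕ) : ℝ)) * Real.log p :=
      mul_lt_mul_of_pos_right (hplace p hp) hlogp
    have h2 : ((T p : ℕ) : ℝ) * Real.log (p : ℝ) ≤ Real.log X := by
      rw [← Real.log_pow]
      exact Real.log_le_log (by positivity) (hX p hp)
    have hl0 : (0 : ℝ) ≤ 4 * (l : ℝ) := by positivity
    calc ((l : ℝ) - 3) * (H p * Real.log p) = ((l : ℝ) - 3) * H p * Real.log p := by ring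
      _ < 4 * (l : ℝ) * (1 + ((T p : ℕ) : ℝ)) * Real.log p := h1
      _ = 4 * (l : ℝ) * (Real.log p + ((T p : ℕ) : ℝ) * Real.log p) := by ring
      _ ≤ 4 * (l : ℝ) * (Real.log p + Real.log X) := by gcongr
  calc ((l : ℝ) - 3) * ∑ p ∈ S, H p * Real.log p = ∑ p ∈ S, ((l : ℝ) - 3) * (H p * Real.log p) := by rw [Finset.mul_sum]
    _ < ∑ p ∈ S, 4 * (l : ℝ) * (Real.log p + Real.log X) := Finset.sum_lt_sum_of_nonempty hne hterm
    _ = 4 * (l : ℝ) * (∑ p ∈ S, Real.log p + (S.card : ℝ) * Real.log X) := by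
        rw [← Finset.mul_sum, Finset.sum_add_distrib, Finset.sum_const, nsmul_eq_mul]

/-- **`N` DISTINCT PRIMES HAVE PRODUCT `≥ N!`** (the `i`-th smallest is `≥ i + 1`; induction on the largest element, which exceeds `#(rest) + 1` since the
rest are primes in `[2, a)`). abc-iut-rh-num-1's step (3), integer half. [folklore] -/
theorem factorial_card_le_prod {S : Finset ℕ} (hS : ∀ p ∈ S, p.Prime) : (S.card).factorial ≤ ∏ p ∈ S, p := by
  induction S using Finset.induction_on_max with
  | empty => simp
  | insert a s hlt ih =>
    have ha : a.Prime := hS a (Finset.mem_insert_self a s)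
    have hs : ∀ p ∈ s, p.Prime := fun p hp => hS p (Finset.mem_insert_of_mem hp)
    have hnot : a ∉ s := fun h => lt_irrefl a (hlt a h)
    rw [Finset.prod_insert hnot, Finset.card_insert_of_notMem hnot, Nat.factorial_succ]
    have hcard : s.card + 1 ≤ a := by
      have hsub : s ⊆ Finset.Ico 2 a := fun p hp => Finset.mem_Ico.2 ⟨(hs p hp).two_le, hlt p hp⟩
      have hc := Finset.card_le_card hsub
      rw [Nat.card_Ico] at hc
      have h2 := ha.two_le
      omega
    exact Nat.mul_le_mul hcard (ih hs)

/-- **`ln N! ≤ ln rad`**: the logarithmic form of `factorial_card_le_prod` (`rad = ∏_{p ∈ S} p`, `ln rad = Σ ln p`). [folklore] -/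
theorem log_factorial_card_le_sum_log {S : Finset ℕ} (hS : ∀ p ∈ S, p.Prime) :
    Real.log (((S.card).factorial : ℕ) : ℝ) ≤ ∑ p ∈ S, Real.log (p : ℝ) := by
  have h := factorial_card_le_prod hS
  have hne : ∀ p ∈ S, ((p : ℝ)) ≠ 0 := fun p hp => by exact_mod_cast (hS p hp).ne_zero
  rw [← Real.log_prod hne]
  have hcast : (((∏ p ∈ S, p : ℕ)) : ℝ) = ∏ p ∈ S, (p : ℝ) := by push_cast; rfl
  rw [← hcast]
  exact Real.log_le_log (by positivity) (by exact_mod_cast h)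

/-- **(3) `N·ln N − N ≤ ln rad`** for a finite set `S` of `N` primes (Mathlib `Stirling.le_log_factorial_stirling`: `N ln N − N + ½ln N + ½ln 2π ≤ ln N!`, the
two dropped terms are `≥ 0`). abc-iut-rh-num-1's «ln rad ≥ ln N! ≥ N(ln N − 1)». [folklore] -/
theorem card_mul_log_sub_card_le_sum_log {S : Finset ℕ} (hS : ∀ p ∈ S, p.Prime) :
    (S.card : ℝ) * Real.log (S.card : ℝ) - S.card ≤ ∑ p ∈ S, Real.log (p : ℝ) := by
  rcases Nat.eq_zero_or_pos S.card with h0 | hpos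
  · have hS0 : S = ∅ := Finset.card_eq_zero.mp h0
    subst hS0
    simp
  · have hst := Stirling.le_log_factorial_stirling (n := S.card) (by omega)
    have h1 : 0 ≤ Real.log (S.card : ℝ) := Real.log_nonneg (by exact_mod_cast hpos)
    have h2 : 0 ≤ Real.log (2 * Real.pi) := Real.log_nonneg (by linarith [Real.two_le_pi])
    have h3 := log_factorial_card_le_sum_log hS
    linarith

/-- **THE SLIVER DISJUNCTION** (abc-iut-rh-num-1's steps (1)–(3) composed; the fixed point is left to the reader's `ν`). Data: a nonempty finite set `S` of
`N` primes, real heights `H_p`, exponents `T_p` with `p^{T_p} ≤ X`, `X ≥ 1`, the per-prime law `(l−3)·H_p < 4l·(1 + T_p)`; put `h := Σ H_p ln p`,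
`R := Σ ln p = ln rad`. Then for EVERY real `ν > e`: either `(l−3)·h < 4l·(R + ν·ln X)` (the case `N < ν`: few bad primes), or
`(l−3)·h < 4l·R·(1 + ln X/(ln ν − 1))` (the case `N ≥ ν`: then `R ≥ N(ln N − 1) ≥ N(ln ν − 1)`, so `N·ln X ≤ R·ln X/(ln ν − 1)`). READING: with `ν = h^{1−η}`
the binding second branch gives `ρ = h/R < (4l/(l−3))·(1 + θ/(1−η) + o(1))`, `θ = ln X/ln h → 1/2` in the window (`X ≈ E·l`, `l ≍ √h` up to logs), so
`ρ_max → 6`. [folklore] -/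
theorem sliver {S : Finset ℕ} (hS : ∀ p ∈ S, p.Prime) (hne : S.Nonempty) (l : ℕ) (H : ℕ → ℝ) (T : ℕ → ℕ)
    {X : ℝ} (hX1 : 1 ≤ X) (hX : ∀ p ∈ S, ((p : ℝ)) ^ (T p) ≤ X)
    (hplace : ∀ p ∈ S, ((l : ℝ) - 3) * H p < 4 * (l : ℝ) * (1 + ((T p : ℕ) : ℝ))) {ν : ℝ} (hν : Real.exp 1 < ν) :
    ((l : ℝ) - 3) * ∑ p ∈ S, H p * Real.log p < 4 * (l : ℝ) * (∑ p ∈ S, Real.log p + ν * Real.log X) ∨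
    ((l : ℝ) - 3) * ∑ p ∈ S, H p * Real.log p <
      4 * (l : ℝ) * (∑ p ∈ S, Real.log p) * (1 + Real.log X / (Real.log ν - 1)) := by
  have hsum := sliver_sum_lt hS hne l H T hX hplace
  have hlogX : 0 ≤ Real.log X := Real.log_nonneg hX1
  have hl0 : (0 : ℝ) ≤ 4 * (l : ℝ) := by positivity
  by_cases hN : (S.card : ℝ) < ν
  · left
    have : (S.card : ℝ) * Real.log X ≤ ν * Real.log X := mul_le_mul_of_nonneg_right hN.le hlogX
    nlinarith
  · right
    rw [not_lt] at hN
    have hν0 : 0 < ν := lt_trans (Real.exp_pos 1) hν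
    have hlogν : 1 < Real.log ν := by
      rw [← Real.log_exp 1]
      exact Real.log_lt_log (Real.exp_pos 1) hν
    have hd : 0 < Real.log ν - 1 := by linarith
    set R := ∑ p ∈ S, Real.log (p : ℝ) with hR
    set N : ℝ := (S.card : ℝ) with hNdef
    have hNpos : 0 < N := lt_of_lt_of_le hν0 hN
    -- `R ≥ N (ln N − 1) ≥ N (ln ν − 1)`
    have hRN : N * Real.log N - N ≤ R := card_mul_log_sub_card_le_sum_log hS
    have hlogN : Real.log ν ≤ Real.log N := Real.log_le_log hν0 hN
    have hRN' : N * (Real.log ν - 1) ≤ R := by nlinarith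
    -- hence `N·ln X ≤ R·ln X/(ln ν − 1)`
    have hNle : N ≤ R / (Real.log ν - 1) := by rw [le_div_iff₀ hd]; exact hRN'
    have hNX : N * Real.log X ≤ R / (Real.log ν - 1) * Real.log X := mul_le_mul_of_nonneg_right hNle hlogX
    calc ((l : ℝ) - 3) * ∑ p ∈ S, H p * Real.log p < 4 * (l : ℝ) * (R + N * Real.log X) := hsum
      _ ≤ 4 * (l : ℝ) * (R + R / (Real.log ν - 1) * Real.log X) := by gcongr
      _ = 4 * (l : ℝ) * R * (1 + Real.log X / (Real.log ν - 1)) := by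
          field_simp

/-- **THE SLIVER DISJUNCTION IN SZPIRO-RATIO FORM** (`ρ := h/R`, `R = ln rad > 0`): for every `ν > e`, either `(l−3)·ρ < 4l·(1 + ν·ln X/R)` or
`(l−3)·ρ < 4l·(1 + ln X/(ln ν − 1))`. At the floor of [IUTchIV]'s window this is abc-iut-rh-num-1's «ρ ≤ 6 + ε(h, l), ε → 0» once `ν` is chosen
`≈ h^{1−η}` (their fixed point 6.35 at h = 2^140, E = 60, reproduced 6.346 by abc-iut-rh2-ref-3 — numbers theirs, not this file's). [folklore] -/
theorem sliver_ratio {S : Finset ℕ} (hS : ∀ p ∈ S, p.Prime) (hne : S.Nonempty) (l : ℕ) (H : ℕ → ℝ) (T : ℕ → ℕ)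
    {X : ℝ} (hX1 : 1 ≤ X) (hX : ∀ p ∈ S, ((p : ℝ)) ^ (T p) ≤ X)
    (hplace : ∀ p ∈ S, ((l : ℝ) - 3) * H p < 4 * (l : ℝ) * (1 + ((T p : ℕ) : ℝ))) {ν : ℝ} (hν : Real.exp 1 < ν) :
    ((l : ℝ) - 3) * ((∑ p ∈ S, H p * Real.log p) / ∑ p ∈ S, Real.log (p : ℝ)) <
        4 * (l : ℝ) * (1 + ν * Real.log X / ∑ p ∈ S, Real.log (p : ℝ)) ∨
    ((l : ℝ) - 3) * ((∑ p ∈ S, H p * Real.log p) / ∑ p ∈ S, Real.log (p : ℝ)) <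
        4 * (l : ℝ) * (1 + Real.log X / (Real.log ν - 1)) := by
  set R := ∑ p ∈ S, Real.log (p : ℝ) with hR
  set h := ∑ p ∈ S, H p * Real.log p with hh
  have hRpos : 0 < R := by
    have : ∀ p ∈ S, 0 < Real.log (p : ℝ) := fun p hp => by
      have hp2 : (2 : ℝ) ≤ (p : ℝ) := by exact_mod_cast (hS p hp).two_le
      exact Real.log_pos (by linarith)
    exact Finset.sum_pos this hne
  rcases sliver hS hne l H T hX1 hX hplace hν with h1 | h2
  · left
    rw [mul_div_assoc', div_lt_iff₀ hRpos]
    calc ((l : ℝ) - 3) * h < 4 * (l : ℝ) * (R + ν * Real.log X) := h1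
      _ = 4 * (l : ℝ) * (1 + ν * Real.log X / R) * R := by field_simp
  · right
    rw [mul_div_assoc', div_lt_iff₀ hRpos]
    calc ((l : ℝ) - 3) * h < 4 * (l : ℝ) * R * (1 + Real.log X / (Real.log ν - 1)) := h2
      _ = 4 * (l : ℝ) * (1 + Real.log X / (Real.log ν - 1)) * R := by ring

/-- **TWO-SCALE (window) form of the sliver disjunction: `ν := h^{1−η}`** (`η < 1`, `h > 0`, `h^{1−η} > e`): either
`(l−3)·h < 4l·(R + h^{1−η}·ln X)` — so `R > ((l−3)/(4l))·h·(1 − o(1))`, `ρ → 4l/(l−3)` — or `(l−3)·h < 4l·R·(1 + ln X/((1−η)·ln h − 1))` — so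
`ρ < (4l/(l−3))·(1 + θ/(1−η) + o(1))`, `θ = ln X/ln h`. With `θ → 1/2` in [IUTchIV]'s window: `ρ_max → 6` (abc-iut-rh-num-1's fixed point). [folklore] -/
theorem sliver_window {S : Finset ℕ} (hS : ∀ p ∈ S, p.Prime) (hne : S.Nonempty) (l : ℕ) (H : ℕ → ℝ) (T : ℕ → ℕ)
    {X : ℝ} (hX1 : 1 ≤ X) (hX : ∀ p ∈ S, ((p : ℝ)) ^ (T p) ≤ X)
    (hplace : ∀ p ∈ S, ((l : ℝ) - 3) * H p < 4 * (l : ℝ) * (1 + ((T p : ℕ) : ℝ))) {η : ℝ}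
    (h0 : 0 < ∑ p ∈ S, H p * Real.log p) (hh : Real.exp 1 < (∑ p ∈ S, H p * Real.log p) ^ (1 - η)) :
    ((l : ℝ) - 3) * ∑ p ∈ S, H p * Real.log p <
        4 * (l : ℝ) * (∑ p ∈ S, Real.log p + (∑ p ∈ S, H p * Real.log p) ^ (1 - η) * Real.log X) ∨
    ((l : ℝ) - 3) * ∑ p ∈ S, H p * Real.log p <
        4 * (l : ℝ) * (∑ p ∈ S, Real.log p) *
          (1 + Real.log X / ((1 - η) * Real.log (∑ p ∈ S, H p * Real.log p) - 1)) := by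
  rcases sliver hS hne l H T hX1 hX hplace (ν := (∑ p ∈ S, H p * Real.log p) ^ (1 - η)) hh with h1 | h2
  · exact Or.inl h1
  · right
    rwa [Real.log_rpow h0] at h2


end Sum

end Summit.ABC.IUTFork.Repair.RH.Q3SliverSum

end
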